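import Literature.AlgebraicGeometry.Resolution.CurveConfigurationMultiplicity
import HarnessLib

/-!
# Configurations of curves under the blowing up of a point, III: one pair of curves through one step

Topic: `Literature/AlgebraicGeometry/Resolution`. Third of four files on the curve-configuration part of steps
1–2 of Cossart–Piltant 2008, Prop. 4.4 (setting: `CurveConfigurationStrictTransform.lean`). For the blowing up
`π : X' → X` of a closed point `x` and two curves `C ⊄ C'` with `C` regular at `x` (or `x ∉ C`):
* `finite_strictTransform_inter` — the strict transforms meet in finitely many points;
* `sum_length_strictTransform_le_and_lt` — **the tangency excess `Σ_p (m_p(C ∩ C') − 1)` does not increase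
  under strict transform, and drops when `x ∈ C ∩ C'` is a non-transverse point** (The Stacks Project, Tag 0BIC,
  proof ¶2: «If the maximum of these numbers is `> 1`, then we can decrease it (Lemma 54.15.3)»; here summed over
  the points: off the exceptional fibre the points and multiplicities correspond bijectively (Tag 02OS), over the
  centre there is at most one common point and its multiplicity is smaller (Tag 0BI7 (3))).

Kernel-checked assembly of tree results; no new definitions. AI-written; weaker than expert review. F-71 is NOT
discharged by this file; no summit statement is proved.

## References
* The Stacks Project, Tags 0BI7, 0BIC, 02OS. [StacksProject]
* V. Cossart, O. Piltant, J. Algebra 320 (2008), Prop. 4.4 (proof, p. 10). [CossartPiltant2008]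
-/

noncomputable section

open CategoryTheory AlgebraicGeometry TopologicalSpace IsLocalRing

universe u

namespace Literature.AlgebraicGeometry.Resolution

open Scheme.IdealSheafData

namespace CurveConfiguration

variable {X X' : Scheme.{u}} {π : X' ⟶ X} {x : X} {hx : IsClosed ({x} : Set X)}

/-! ## One pair of curves through a step at a point where both are regular -/

/-- The strict transforms of two curves, each either regular at `x` or not passing through `x`, meet in
finitely many points if the curves do. [cite: StacksProject, Tag 0BIC (Lemma 54.15.6, proof)] -/
theorem finite_strictTransform_inter [IsLocallyNoetherian X] [IsLocallyNoetherian X']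
    (hπ : IsBlowup π (vanishingIdeal ⟨{x}, hx⟩)) (C C' : Closeds X)
    [IsIntegral (vanishingIdeal C).subscheme] (hdimC : topologicalKrullDim (vanishingIdeal C).subscheme = 1)
    (hregC : x ∉ (vanishingIdeal C).subschemeι '' (Scheme.regularLocus (vanishingIdeal C).subscheme)ᶜ)
    (hF : ((C : Set X) ∩ C').Finite) :
    (closure (π ⁻¹' ((C : Set X) \ {x})) ∩ closure (π ⁻¹' ((C' : Set X) \ {x}))).Finite := by
  -- off the exceptional fibre: the preimage of the finite set `C ∩ C' ∖ {x}` under the injective `π`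
  have hoff : (π ⁻¹' (((C : Set X) ∩ C') \ {x})).Finite := by
    refine Set.Finite.preimage (fun q hq q' hq' h => ?_) (hF.subset Set.sdiff_subset)
    have hne : π q ≠ x := hq.2
    exact (IsBlowup.existsUnique_preimage_of_ne hπ (coe_support_vanishingIdeal _) hne).unique rfl h.symm
  -- over `x`: at most one point
  have hon : (closure (π ⁻¹' ((C : Set X) \ {x})) ∩ π ⁻¹' {x}).Finite := by
    by_cases hxC : x ∈ (C : Set X)
    · obtain ⟨c, hc⟩ := exists_subschemeι_eq C hxC
      have hreg : IsRegularLocalRing ((vanishingIdeal C).subscheme.presheaf.stalk c) := by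
        by_contra h; exact hregC ⟨c, h, hc⟩
      obtain ⟨q₀, hq₀⟩ := exists_strictTransform_inter_fibre_eq hπ C hdimC hc hreg
      rw [hq₀]; exact Set.finite_singleton q₀
    · rw [closure_preimage_diff_inter_preimage_singleton_eq_empty π.continuous C hxC]
      exact Set.finite_empty
  refine (hoff.union hon).subset fun q hq => ?_
  by_cases hqx : π q = x
  · exact Or.inr ⟨hq.1, hqx⟩
  · refine Or.inl ⟨⟨?_, ?_⟩, hqx⟩
    · exact (mem_closure_preimage_diff_iff π.continuous C hqx).mp hq.1
    · exact (mem_closure_preimage_diff_iff π.continuous C' hqx).mp hq.2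

/-- `ENat.toNat` is strictly monotone below a finite bound. [folklore] -/
private theorem toNat_lt_toNat_of_lt_of_ne_top {a b : ℕ∞} (h : a < b) (hb : b ≠ ⊤) : a.toNat < b.toNat := by
  have ha : a ≠ ⊤ := ne_top_of_lt h
  lift a to ℕ using ha
  lift b to ℕ using hb
  simpa using h

/-- **One pair of curves through one point blow-up, at a centre where the first curve is regular (or absent):
the tangency excess `Σ_p (m_p(C ∩ C') − 1)` of the strict transforms does not exceed that of the curves, and
drops if the curves meet non-transversally at the centre** (Stacks Tag 0BIC, proof ¶2, via Tag 0BI7 (3) over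
the centre and Tag 02OS off it). [cite: StacksProject, Tag 0BIC (Lemma 54.15.6, proof)]
[cite: StacksProject, Tag 0BI7 (Lemma 54.15.3 (3))] -/
theorem sum_length_strictTransform_le_and_lt [IsLocallyNoetherian X] [IsLocallyNoetherian X']
    (hπ : IsBlowup π (vanishingIdeal ⟨{x}, hx⟩)) (C C' : Closeds X)
    [IsIntegral (vanishingIdeal C).subscheme] (hdimC : topologicalKrullDim (vanishingIdeal C).subscheme = 1)
    [IsIntegral (vanishingIdeal C').subscheme] (hdimC' : topologicalKrullDim (vanishingIdeal C').subscheme = 1)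
    (hCC' : ¬ (C : Set X) ⊆ C')
    (hregC : x ∉ (vanishingIdeal C).subschemeι '' (Scheme.regularLocus (vanishingIdeal C).subscheme)ᶜ)
    (hF : ((C : Set X) ∩ C').Finite)
    (hF' : (closure (π ⁻¹' ((C : Set X) \ {x})) ∩ closure (π ⁻¹' ((C' : Set X) \ {x}))).Finite) :
    (∑ q ∈ hF'.toFinset, ((Module.length (X'.presheaf.stalk q) (X'.presheaf.stalk q ⧸
        (stalkIdeal (vanishingIdeal ⟨closure (π ⁻¹' ((C : Set X) \ {x})), isClosed_closure⟩) q ⊔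
          stalkIdeal (vanishingIdeal ⟨closure (π ⁻¹' ((C' : Set X) \ {x})), isClosed_closure⟩) q))).toNat - 1) ≤
      ∑ p ∈ hF.toFinset, ((Module.length (X.presheaf.stalk p) (X.presheaf.stalk p ⧸
        (stalkIdeal (vanishingIdeal C) p ⊔ stalkIdeal (vanishingIdeal C') p))).toNat - 1)) ∧
    (x ∈ (C : Set X) → x ∈ (C' : Set X) →
      stalkIdeal (vanishingIdeal C) x ⊔ stalkIdeal (vanishingIdeal C') x ≠ maximalIdeal (X.presheaf.stalk x) →
      ∑ q ∈ hF'.toFinset, ((Module.length (X'.presheaf.stalk q) (X'.presheaf.stalk q ⧸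
        (stalkIdeal (vanishingIdeal ⟨closure (π ⁻¹' ((C : Set X) \ {x})), isClosed_closure⟩) q ⊔
          stalkIdeal (vanishingIdeal ⟨closure (π ⁻¹' ((C' : Set X) \ {x})), isClosed_closure⟩) q))).toNat - 1) <
      ∑ p ∈ hF.toFinset, ((Module.length (X.presheaf.stalk p) (X.presheaf.stalk p ⧸
        (stalkIdeal (vanishingIdeal C) p ⊔ stalkIdeal (vanishingIdeal C') p))).toNat - 1)) := by
  classical
  set m' : X' → ℕ := fun q => (Module.length (X'.presheaf.stalk q) (X'.presheaf.stalk q ⧸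
        (stalkIdeal (vanishingIdeal ⟨closure (π ⁻¹' ((C : Set X) \ {x})), isClosed_closure⟩) q ⊔
          stalkIdeal (vanishingIdeal ⟨closure (π ⁻¹' ((C' : Set X) \ {x})), isClosed_closure⟩) q))).toNat
    with hm'def
  set m : X → ℕ := fun p => (Module.length (X.presheaf.stalk p) (X.presheaf.stalk p ⧸
        (stalkIdeal (vanishingIdeal C) p ⊔ stalkIdeal (vanishingIdeal C') p))).toNat with hmdef
  set Q := hF'.toFinset with hQdef
  set P := hF.toFinset with hPdef
  change (∑ q ∈ Q, (m' q - 1) ≤ ∑ p ∈ P, (m p - 1)) ∧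
    (x ∈ (C : Set X) → x ∈ (C' : Set X) →
      stalkIdeal (vanishingIdeal C) x ⊔ stalkIdeal (vanishingIdeal C') x ≠ maximalIdeal (X.presheaf.stalk x) →
      ∑ q ∈ Q, (m' q - 1) < ∑ p ∈ P, (m p - 1))
  -- (1) off the exceptional fibre the terms correspond bijectively
  have hoff : ∑ q ∈ Q.filter (fun q => π q ≠ x), (m' q - 1) = ∑ p ∈ P.filter (fun p => p ≠ x), (m p - 1) := by
    apply Finset.sum_nbij (fun q => π q)
    · intro q hq
      rw [Finset.mem_filter, hQdef, Set.Finite.mem_toFinset] at hq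
      rw [Finset.mem_filter, hPdef, Set.Finite.mem_toFinset]
      exact ⟨⟨(mem_closure_preimage_diff_iff π.continuous C hq.2).mp hq.1.1,
        (mem_closure_preimage_diff_iff π.continuous C' hq.2).mp hq.1.2⟩, hq.2⟩
    · intro q hq q' hq' h
      rw [Finset.coe_filter] at hq hq'
      exact (IsBlowup.existsUnique_preimage_of_ne hπ (coe_support_vanishingIdeal _) hq.2).unique rfl h.symm
    · intro p hp
      rw [Finset.coe_filter, hPdef] at hp
      obtain ⟨hpP, hpx⟩ := hp
      rw [Set.Finite.mem_toFinset] at hpP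
      obtain ⟨hpC, hpC'⟩ := hpP
      obtain ⟨q, hq, -⟩ := IsBlowup.existsUnique_preimage_of_ne hπ (coe_support_vanishingIdeal _) hpx
      have hqx : π q ≠ x := by rw [hq]; exact hpx
      refine ⟨q, ?_, hq⟩
      rw [Finset.coe_filter, hQdef]
      refine ⟨?_, hqx⟩
      rw [Set.Finite.mem_toFinset]
      exact ⟨(mem_closure_preimage_diff_iff π.continuous C hqx).mpr (hq ▸ hpC),
        (mem_closure_preimage_diff_iff π.continuous C' hqx).mpr (hq ▸ hpC')⟩
    · intro q hq
      rw [Finset.mem_filter] at hq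
      simp only [hm'def, hmdef]
      rw [length_strictTransform_eq_of_ne hπ C C' hdimC hdimC' hq.2]
  -- (2) over the centre
  have hsplitQ := Finset.sum_filter_add_sum_filter_not Q (fun q => π q ≠ x) (fun q => m' q - 1)
  have hsplitP := Finset.sum_filter_add_sum_filter_not P (fun p => p ≠ x) (fun p => m p - 1)
  -- the fibre part of `Q` and of `P`
  by_cases hxC : x ∈ (C : Set X)
  · obtain ⟨c, hc⟩ := exists_subschemeι_eq C hxC
    have hreg : IsRegularLocalRing ((vanishingIdeal C).subscheme.presheaf.stalk c) := by
      by_contra h; exact hregC ⟨c, h, hc⟩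
    by_cases hxC' : x ∈ (C' : Set X)
    · obtain ⟨q₀, hq₀, hlt⟩ :=
        exists_strictTransform_inter_fibre_eq_and_length_lt hπ C C' hdimC hdimC' hxC' hCC' hc hreg
      -- finiteness of `m_x`
      have hη : (vanishingIdeal C).subschemeι (genericPoint (vanishingIdeal C).subscheme) ∉ (C' : Set X) :=
        fun h => hCC' (subset_of_subschemeι_genericPoint_mem C C' h)
      haveI : IsLocallyNoetherian (vanishingIdeal C).subscheme :=
        LocallyOfFiniteType.isLocallyNoetherian (vanishingIdeal C).subschemeι
      have hfinx := length_stalk_quotient_sup_ne_top C C' hdimC c hη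
      rw [hc] at hfinx
      have hm'q₀ : m' q₀ < m x := toNat_lt_toNat_of_lt_of_ne_top hlt hfinx
      have h1x : 1 ≤ m x := by
        have h := one_le_length_stalk_quotient_sup C C' hxC hxC'
        change 1 ≤ (Module.length (X.presheaf.stalk x) (X.presheaf.stalk x ⧸
          (stalkIdeal (vanishingIdeal C) x ⊔ stalkIdeal (vanishingIdeal C') x))).toNat
        have := ENat.toNat_le_toNat h hfinx
        simpa using this
      -- the fibre parts
      have hPx : P.filter (fun p => ¬ p ≠ x) = {x} := by
        ext p
        simp only [Finset.mem_filter, hPdef, Set.Finite.mem_toFinset, Set.mem_inter_iff, not_not,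
          Finset.mem_singleton]
        constructor
        · rintro ⟨-, rfl⟩; rfl
        · rintro rfl; exact ⟨⟨hxC, hxC'⟩, rfl⟩
      have hQx : Q.filter (fun q => ¬ π q ≠ x) ⊆ {q₀} := by
        intro q hq
        simp only [Finset.mem_filter, hQdef, Set.Finite.mem_toFinset, not_not] at hq
        have : q ∈ closure (π ⁻¹' ((C : Set X) \ {x})) ∩ π ⁻¹' {x} := ⟨hq.1.1, hq.2⟩
        rw [hq₀] at this
        exact Finset.mem_singleton.mpr this
      have hfib_le : ∑ q ∈ Q.filter (fun q => ¬ π q ≠ x), (m' q - 1) ≤ m' q₀ - 1 := by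
        calc ∑ q ∈ Q.filter (fun q => ¬ π q ≠ x), (m' q - 1) ≤ ∑ q ∈ ({q₀} : Finset X'), (m' q - 1) :=
              Finset.sum_le_sum_of_subset hQx
          _ = m' q₀ - 1 := Finset.sum_singleton _ _
      constructor
      · rw [← hsplitQ, ← hsplitP, hoff, hPx, Finset.sum_singleton]
        apply Nat.add_le_add_left
        exact hfib_le.trans (by omega)
      · intro _ _ hne
        have hmx : m x ≠ 1 := by
          intro h1
          apply hne
          apply (length_stalk_quotient_sup_eq_one_iff C C' x).mp
          have hfin' := hfinx
          change (Module.length (X.presheaf.stalk x) (X.presheaf.stalk x ⧸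
            (stalkIdeal (vanishingIdeal C) x ⊔ stalkIdeal (vanishingIdeal C') x))).toNat = 1 at h1
          rw [← ENat.coe_toNat hfinx, h1]; rfl
        rw [← hsplitQ, ← hsplitP, hoff, hPx, Finset.sum_singleton]
        apply Nat.add_lt_add_left
        exact lt_of_le_of_lt hfib_le (by omega)
    · -- `x ∉ C'`: no point of the strict transforms over `x`
      have hQx : Q.filter (fun q => ¬ π q ≠ x) = ∅ := by
        ext q
        simp only [Finset.mem_filter, hQdef, Set.Finite.mem_toFinset, not_not, Finset.notMem_empty, iff_false,
          not_and]
        intro hq hqx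
        have : q ∈ closure (π ⁻¹' ((C' : Set X) \ {x})) ∩ π ⁻¹' {x} := ⟨hq.2, hqx⟩
        rw [closure_preimage_diff_inter_preimage_singleton_eq_empty π.continuous C' hxC'] at this
        exact this
      constructor
      · rw [← hsplitQ, ← hsplitP, hoff, hQx, Finset.sum_empty]
        exact Nat.le_add_right _ _ |>.trans (Nat.add_le_add_left (Nat.zero_le _) _)
      · intro _ h; exact absurd h hxC'
  · have hQx : Q.filter (fun q => ¬ π q ≠ x) = ∅ := by
      ext q
      simp only [Finset.mem_filter, hQdef, Set.Finite.mem_toFinset, not_not, Finset.notMem_empty, iff_false,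
        not_and]
      intro hq hqx
      have : q ∈ closure (π ⁻¹' ((C : Set X) \ {x})) ∩ π ⁻¹' {x} := ⟨hq.1, hqx⟩
      rw [closure_preimage_diff_inter_preimage_singleton_eq_empty π.continuous C hxC] at this
      exact this
    constructor
    · rw [← hsplitQ, ← hsplitP, hoff, hQx, Finset.sum_empty]
      exact Nat.le_add_right _ _ |>.trans (Nat.add_le_add_left (Nat.zero_le _) _)
    · intro h; exact absurd h hxC

end CurveConfiguration

end Literature.AlgebraicGeometry.Resolution

end
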